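import Summits.Ventures.HodgeRepro2.T5SU11JacobiOrbitDiscLaw
import Mathlib.Analysis.SpecialFunctions.PolarCoord

/-!
# The angle of the orbit point is uniform and independent of the radius (polar coordinates)

`T5SU11JacobiOrbitDiscLaw` gives the law of the orbit point `g·0` under `m_k φ_λ dν` as the radial area
density `ρ_{k,λ}(|z|) = (1 − |z|²)^{k/2−2} Φ_λ(−½ log(1 − |z|²))` on the disc. In polar coordinates
(Mathlib's `Complex.integral_comp_polarCoord_symm`, `z = r e^{iθ}`, `dA = r dr dθ`, `r ∈ (0, ∞)`,
`θ ∈ (−π, π)`) an angular-times-radial integrand factorises without any integrability hypothesis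
(`integral_prod_mul`):

  **`∫_{|z|<1} h(arg z) ψ(|z|) dA = (∫_{−π}^{π} h(θ) dθ) · ∫_0^1 r ψ(r) dr`**   (`integral_ball_angular_mul_radial`).

Hence, for measurable `h` (of the angle) and `ψ` (of the radius),

  **`∫_G h(arg(g·0)) ψ(|g·0|) m_k φ_λ dν = (∫_{−π}^{π} h) · ∫_0^1 r ψ(r) ρ_{k,λ}(r) dr`**   (`integral_angle_mul_radial_eq`),

so that `m̂_k(λ) = 2π ∫_0^1 r ρ_{k,λ}(r) dr` (`jacobi_eq_polar`), the angle `arg(g·0)` is UNIFORM on `(−π, π]`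
under `m_k φ_λ dν/m̂_k(λ)` — `E_{k,λ}[h(arg(g·0))] = (1/2π) ∫_{−π}^{π} h` (`expectation_angle_eq`) — and
**the angle and the radius are independent**: `E_{k,λ}[h(arg(g·0)) ψ(|g·0|)] = E_{k,λ}[h(arg(g·0))] · E_{k,λ}[ψ(|g·0|)]`
(`expectation_angle_mul_radial_eq`), for every weight `k` on the ray and every spectral parameter `λ`. This is
the explicit form of the rotation invariance of `T5SU11JacobiOrbitRotationLaw`. Nothing is claimed about (N).

Blind lane: Mathlib + the HodgeRepro2 prefix only; no sorry; axioms ⊆ {propext, Classical.choice,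
Quot.sound}.
-/

namespace Summit.Ventures.HodgeRepro2.T5SU11JacobiOrbitAngleLaw

open MeasureTheory MeasureTheory.Measure Metric Set Filter Topology
open T5SU11Unimodular T5SU11Fibration T5SU11Cartan T5HaarCircle T5BergmanCoefficient
  T5SU11FibrationHaar T5SU11SphericalFunction T5SU11SphericalSymmetry T5SU11SphericalBounds
  T5SU11SphericalContinuous T5SU11JacobiIwasawa T5SU11JacobiTransform T5SU11JacobiWeight
  T5SU11KFiniteMajorantPow T5SU11OrbitMeasure T5PoincareMeasure T5SU11JacobiLaplacePhase
  T5SU11JacobiOrbitDiscLaw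
open scoped Real

/-! ### Polar coordinates on the disc -/

/-- The polar form of the disc-indicator integrand: on the target `(0, ∞) × (−π, π)`,
`r • 1_𝔻(r e^{iθ}) h(arg(r e^{iθ})) ψ(|r e^{iθ}|) = 1_{(0,1)}(r) r ψ(r) · h(θ)`. -/
theorem polar_integrand_eq (h ψ : ℝ → ℝ) {p : ℝ × ℝ} (hp : p ∈ polarCoord.target) :
    p.1 • (ball (0 : ℂ) 1).indicator (fun z => h (Complex.arg z) * ψ ‖z‖) (Complex.polarCoord.symm p)
      = (Ioo (0 : ℝ) 1).indicator (fun r => r * ψ r) p.1 * h p.2 := by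
  have hp' : 0 < p.1 ∧ p.2 ∈ Ioo (-π) π := by simpa [polarCoord] using hp
  have hnorm : ‖Complex.polarCoord.symm p‖ = p.1 := by
    rw [Complex.norm_polarCoord_symm, abs_of_pos hp'.1]
  have harg : Complex.arg (Complex.polarCoord.symm p) = p.2 := by
    rw [Complex.polarCoord_symm_apply, Complex.ofReal_cos, Complex.ofReal_sin]
    exact Complex.arg_mul_cos_add_sin_mul_I hp'.1 ⟨hp'.2.1, hp'.2.2.le⟩
  by_cases h1 : p.1 < 1
  · have hmem : Complex.polarCoord.symm p ∈ ball (0 : ℂ) 1 := by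
      rw [mem_ball_zero_iff, hnorm]
      exact h1
    rw [indicator_of_mem hmem, indicator_of_mem (show p.1 ∈ Ioo (0 : ℝ) 1 from ⟨hp'.1, h1⟩), hnorm, harg,
      smul_eq_mul]
    ring
  · have hmem : Complex.polarCoord.symm p ∉ ball (0 : ℂ) 1 := by
      rw [mem_ball_zero_iff, hnorm]
      exact h1
    rw [indicator_of_notMem hmem, indicator_of_notMem (show p.1 ∉ Ioo (0 : ℝ) 1 from
      fun hm => h1 hm.2), smul_zero, zero_mul]

/-- **Polar factorisation on the disc**: for any `h ψ : ℝ → ℝ`,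
`∫_{|z|<1} h(arg z) ψ(|z|) dA = (∫_{−π}^{π} h(θ) dθ) · ∫_0^1 r ψ(r) dr`. -/
theorem integral_ball_angular_mul_radial (h ψ : ℝ → ℝ) :
    ∫ z in ball (0 : ℂ) 1, h (Complex.arg z) * ψ ‖z‖
      = (∫ θ in Ioo (-π) π, h θ) * ∫ r in Ioo (0 : ℝ) 1, r * ψ r := by
  rw [← integral_indicator measurableSet_ball, ← Complex.integral_comp_polarCoord_symm,
    setIntegral_congr_fun polarCoord.open_target.measurableSet
      (fun p hp => polar_integrand_eq h ψ hp)]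
  have ht : polarCoord.target = Ioi (0 : ℝ) ×ˢ Ioo (-π) π := rfl
  rw [ht, Measure.volume_eq_prod, ← Measure.prod_restrict, integral_prod_mul,
    integral_indicator measurableSet_Ioo, Measure.restrict_restrict measurableSet_Ioo,
    show Ioo (0 : ℝ) 1 ∩ Ioi 0 = Ioo 0 1 from inter_eq_left.mpr Ioo_subset_Ioi_self]
  ring

section measure

variable [MeasurableSpace Circle] [BorelSpace Circle]

/-- The radial area density `ρ_{k,λ}(r) = (1 − r²)^{k/2−2} Φ_λ(−½ log(1 − r²))` is measurable. -/
theorem measurable_radialDensity (k lam : ℝ) :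
    Measurable fun r : ℝ => (1 - r ^ 2) ^ (k / 2 - 2) * sphPhase lam (-(1 / 2) * Real.log (1 - r ^ 2)) := by
  have h0 : Measurable fun r : ℝ => 1 - r ^ 2 := measurable_const.sub (measurable_id.pow_const 2)
  exact (h0.pow_const _).mul
    ((continuous_sphPhase lam).measurable.comp (measurable_const.mul (Real.measurable_log.comp h0)))

/-- **The angle–radius integrals factorise on the group**: for measurable `h`, `ψ`,
`∫_G h(arg(g·0)) ψ(|g·0|) m_k φ_λ dν = (∫_{−π}^{π} h) · ∫_0^1 r ψ(r) ρ_{k,λ}(r) dr`. -/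
theorem integral_angle_mul_radial_eq {h ψ : ℝ → ℝ} (hh : Measurable h) (hψ : Measurable ψ)
    (k lam : ℝ) :
    ∫ g, h (Complex.arg (orbit g)) * ψ ‖orbit g‖ * ((1 - ‖orbit g‖ ^ 2) ^ (k / 2) * sph lam g)
        ∂(nu haarCircle)
      = (∫ θ in Ioo (-π) π, h θ) * ∫ r in Ioo (0 : ℝ) 1,
          r * (ψ r * ((1 - r ^ 2) ^ (k / 2 - 2) * sphPhase lam (-(1 / 2) * Real.log (1 - r ^ 2)))) := by
  have hF : Measurable fun z : ℂ => h (Complex.arg z) * ψ ‖z‖ :=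
    (hh.comp Complex.measurable_arg).mul (hψ.comp measurable_norm)
  rw [integral_orbit_mul_eq_ball hF k lam, ← integral_ball_angular_mul_radial h
    (fun r => ψ r * ((1 - r ^ 2) ^ (k / 2 - 2) * sphPhase lam (-(1 / 2) * Real.log (1 - r ^ 2))))]
  refine setIntegral_congr_fun measurableSet_ball fun z _ => ?_
  ring

/-- **`m̂_k(λ) = 2π ∫_0^1 r ρ_{k,λ}(r) dr`** (the case `h = ψ = 1`). -/
theorem jacobi_eq_polar (k lam : ℝ) :
    ∫ g, (1 - ‖orbit g‖ ^ 2) ^ (k / 2) * sph lam g ∂(nu haarCircle)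
      = 2 * π * ∫ r in Ioo (0 : ℝ) 1,
          r * ((1 - r ^ 2) ^ (k / 2 - 2) * sphPhase lam (-(1 / 2) * Real.log (1 - r ^ 2))) := by
  have h := integral_angle_mul_radial_eq (h := fun _ => (1 : ℝ)) (ψ := fun _ => (1 : ℝ))
    measurable_const measurable_const k lam
  simp only [one_mul, mul_one] at h
  rw [h, setIntegral_const, smul_eq_mul, mul_one, measureReal_def, Real.volume_Ioo,
    ENNReal.toReal_ofReal (by linarith [Real.pi_pos])]
  ring

/-- **The angle is uniform**: for measurable `h`, on the ray,
`E_{k,λ}[h(arg(g·0))] = (1/2π) ∫_{−π}^{π} h(θ) dθ`. -/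
theorem expectation_angle_eq {h : ℝ → ℝ} (hh : Measurable h) {k lam : ℝ} (hk : 1 < k) (h1 : lam < k)
    (h2 : 2 < k + lam) :
    (∫ g, h (Complex.arg (orbit g)) * ((1 - ‖orbit g‖ ^ 2) ^ (k / 2) * sph lam g) ∂(nu haarCircle))
        / ∫ g, (1 - ‖orbit g‖ ^ 2) ^ (k / 2) * sph lam g ∂(nu haarCircle)
      = (∫ θ in Ioo (-π) π, h θ) / (2 * π) := by
  have e := integral_angle_mul_radial_eq (ψ := fun _ => (1 : ℝ)) hh measurable_const k lam
  simp only [mul_one, one_mul] at e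
  have hm : ∫ g, (1 - ‖orbit g‖ ^ 2) ^ (k / 2) * sph lam g ∂(nu haarCircle) ≠ 0 :=
    (jacobi_pos hk h1 h2).ne'
  have hR : ∫ r in Ioo (0 : ℝ) 1,
      r * ((1 - r ^ 2) ^ (k / 2 - 2) * sphPhase lam (-(1 / 2) * Real.log (1 - r ^ 2))) ≠ 0 := by
    intro h0
    rw [jacobi_eq_polar, h0, mul_zero] at hm
    exact hm rfl
  rw [e, jacobi_eq_polar k lam, mul_div_mul_right _ _ hR]

/-- **The angle and the radius are independent**: for measurable `h`, `ψ`, on the ray,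
`E_{k,λ}[h(arg(g·0)) ψ(|g·0|)] = E_{k,λ}[h(arg(g·0))] · E_{k,λ}[ψ(|g·0|)]`. -/
theorem expectation_angle_mul_radial_eq {h ψ : ℝ → ℝ} (hh : Measurable h) (hψ : Measurable ψ)
    {k lam : ℝ} (hk : 1 < k) (h1 : lam < k) (h2 : 2 < k + lam) :
    (∫ g, h (Complex.arg (orbit g)) * ψ ‖orbit g‖ * ((1 - ‖orbit g‖ ^ 2) ^ (k / 2) * sph lam g)
        ∂(nu haarCircle)) / ∫ g, (1 - ‖orbit g‖ ^ 2) ^ (k / 2) * sph lam g ∂(nu haarCircle)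
      = ((∫ g, h (Complex.arg (orbit g)) * ((1 - ‖orbit g‖ ^ 2) ^ (k / 2) * sph lam g) ∂(nu haarCircle))
          / ∫ g, (1 - ‖orbit g‖ ^ 2) ^ (k / 2) * sph lam g ∂(nu haarCircle))
        * ((∫ g, ψ ‖orbit g‖ * ((1 - ‖orbit g‖ ^ 2) ^ (k / 2) * sph lam g) ∂(nu haarCircle))
          / ∫ g, (1 - ‖orbit g‖ ^ 2) ^ (k / 2) * sph lam g ∂(nu haarCircle)) := by
  have eh := integral_angle_mul_radial_eq (ψ := fun _ => (1 : ℝ)) hh measurable_const k lam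
  have eψ := integral_angle_mul_radial_eq (h := fun _ => (1 : ℝ)) measurable_const hψ k lam
  have ehψ := integral_angle_mul_radial_eq hh hψ k lam
  simp only [mul_one, one_mul] at eh eψ
  have hm : ∫ g, (1 - ‖orbit g‖ ^ 2) ^ (k / 2) * sph lam g ∂(nu haarCircle) ≠ 0 :=
    (jacobi_pos hk h1 h2).ne'
  rw [ehψ, eh, eψ, jacobi_eq_polar k lam]
  have hR : ∫ r in Ioo (0 : ℝ) 1,
      r * ((1 - r ^ 2) ^ (k / 2 - 2) * sphPhase lam (-(1 / 2) * Real.log (1 - r ^ 2))) ≠ 0 := by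
    intro h0
    rw [jacobi_eq_polar, h0, mul_zero] at hm
    exact hm rfl
  have hpi : (2 * π : ℝ) ≠ 0 := by positivity
  rw [setIntegral_const, smul_eq_mul, mul_one, measureReal_def, Real.volume_Ioo,
    ENNReal.toReal_ofReal (by linarith [Real.pi_pos])]
  set A := ∫ θ in Ioo (-π) π, h θ with hA
  set R := ∫ r in Ioo (0 : ℝ) 1,
    r * ((1 - r ^ 2) ^ (k / 2 - 2) * sphPhase lam (-(1 / 2) * Real.log (1 - r ^ 2))) with hRdef
  set Rψ := ∫ r in Ioo (0 : ℝ) 1,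
    r * (ψ r * ((1 - r ^ 2) ^ (k / 2 - 2) * sphPhase lam (-(1 / 2) * Real.log (1 - r ^ 2)))) with hRψ
  field_simp
  ring

end measure

end Summit.Ventures.HodgeRepro2.T5SU11JacobiOrbitAngleLaw
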